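import Summits.Ventures.CertifiedManyBodySolver.Observables.RungLeavesCoverageNdNiO2Cut
import Summits.Ventures.CertifiedManyBodySolver.Certificates.HubbardSquare_NdM21DetBoxE_stiffness_kinematic
import Summits.Ventures.CertifiedManyBodySolver.Downfold.BoxesNdNiO2ELadderB
import HarnessLib

/-!
# Ventures/CertifiedManyBodySolver — Observables/RungLeavesCoverageNdNiO2Det.lean

HONEST FRAMING: a node-free kinematic CALIBRATION statement about the downfolded NdNiO₂ box: on the DETERMINATION-HULL sub-box `boxNdNiO2E_M21det`
(`Downfold/BoxesNdNiO2ELadderB.lean` §3: the un-padded rungs `U/t ∈ [6175/1172, 8000/959]`, `t′/t ∈ [−91/200, −9/25]`, `n ∈ [87/100, 117/125]`) the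
obligation SHAPE of the rung leaf «MOS2-ndnio2-M21» (bar `0.4779578 = 0.98 × κ₂₁`) is met by one-body kinematics alone — `StiffnessBoxCeilingBelow boxNdNiO2E_M21det
(4779578/10⁷)` UNCONDITIONALLY. Reading (captain pointer «DET-HULL CLOSURE», wording class (xx1)): every bit of many-body content of the leaf on the box OF
RECORD `boxNdNiO2E_M21` lives in the padding band (`t′ ∈ [−23/50, −91/200)` from FLOOR(tp/t) + print, `n ∈ (117/125, 477/500]` from the INFL-4f dsd floor);
this does NOT close «MOS2-ndnio2-M21» (its box is the padded box of record), touches no crux, certifies no suppression, and never speaks to the presence of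
order; not a `T_c` or phase-diagram statement; no summit statement is proved here.

Cell `pub/hubbard-obs` (MO-S2, D-0154 (1)(C) COVERAGE: NdNiO₂), seat `hubbard-cov-ndnio2-box-2` (`prover-hubbard-cov-ndnio2-box-2-0`). Pieces: the `t′`-cut
leaf `ndM21CutBoxE_stiffnessSeqLeaf` (`t′ ∈ [−11/25, −9/25]`, `n ≤ 477/500` ⇒ `0.4768946`, `M = 128`) and the determination-hull deep leaf
`ndM21DetBoxE_stiffnessSeqLeaf` (`t′ ∈ [−91/200, −11/25]`, `n ≤ 117/125` ⇒ `0.4770906`, `M = 256` corner), glued by `le_total tp (−11/25)` and `.mono`.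

References: D. J. Scalapino, S. R. White, S.-C. Zhang, PRB 47 (1993) 7995, §II [ScalapinoWhiteZhang1993]; T. Hazra, N. Verma, M. Randeria,
PRX 9 (2019) 031049, eqs. (2)–(6) [HazraVermaRanderia2019].
-/

noncomputable section

namespace Summit.Ventures.CertifiedManyBodySolver.Observables

open Set NonemptyInterval
open Summit.Ventures.CertifiedManyBodySolver.Downfold
open Summit.Ventures.CertifiedManyBodySolver.Certificates

/-- The two kinematic constants of the determination hull sit below the bar: `0.4770906 < 0.4779578` (deep part, `M = 256`) and `0.4768946 < 0.4779578`
(shallow part, `M = 128`). [folklore] -/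
theorem ndnio2_det_constants_below_bar :
    (4770906 / 10000000 : ℚ) < 4779578 / 10000000 ∧ (4768946 / 10000000 : ℚ) < 4779578 / 10000000 := by
  constructor <;> norm_num

/-- Coordinates of a point of a delivered box `Set.Icc ![a, b, c] ![a', b', c']` (order `(U/t, t′/t, n)`). [folklore] -/
private theorem mem_s2Box_vec3D {a b c a' b' c' : ℝ} {θ : Fin 3 → ℝ}
    (hθ : θ ∈ Set.Icc (![a, b, c] : Fin 3 → ℝ) ![a', b', c']) :
    (a ≤ θ 0 ∧ θ 0 ≤ a') ∧ (b ≤ θ 1 ∧ θ 1 ≤ b') ∧ (c ≤ θ 2 ∧ θ 2 ≤ c') := by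
  rw [Set.mem_Icc, Pi.le_def, Pi.le_def] at hθ
  obtain ⟨hlo, hhi⟩ := hθ
  have h0 := hlo 0; have h1 := hlo 1; have h2 := hlo 2
  have h0' := hhi 0; have h1' := hhi 1; have h2' := hhi 2
  simp only [Matrix.cons_val_zero, Matrix.cons_val_one, Matrix.head_cons, Matrix.cons_val_two,
    Matrix.tail_cons] at h0 h1 h2 h0' h1' h2'
  exact ⟨⟨h0, h0'⟩, ⟨h1, h1'⟩, ⟨h2, h2'⟩⟩

/-- **The determination-hull cell at the bar, node-free**: `ObsStiffnessSeqCeilingAt tp U n (4779578/10⁷)` for every `tp ∈ [−91/200, −9/25]`,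
`n ∈ [87/100, 117/125]` and every `U` (deep part by the `M = 256` leaf, shallow part by the `M = 128` cut leaf, both by `.mono`).
[cite: HazraVermaRanderia2019, eqs. (2)-(6)] -/
theorem ndnio2_M21det_cell_kinematic_below_bar {tp U n : ℝ} (htp : tp ∈ Set.Icc (-91 / 200 : ℝ) (-9 / 25))
    (hn : n ∈ Set.Icc (87 / 100 : ℝ) (117 / 125)) : ObsStiffnessSeqCeilingAt tp U n (4779578 / 10000000) := by
  rcases le_total tp (-11 / 25) with h | h
  · exact (ndM21DetBoxE_stiffnessSeqLeaf ⟨htp.1, h⟩ (by linarith [hn.1]) hn.2).mono ndnio2_det_constants_below_bar.1.le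
  · exact (ndM21CutBoxE_stiffnessSeqLeaf ⟨h, htp.2⟩ (by linarith [hn.1]) (by linarith [hn.2])).mono
      ndnio2_det_constants_below_bar.2.le

/-- **«DET-HULL CLOSURE» (node-free, zero solve): `StiffnessBoxCeilingBelow boxNdNiO2E_M21det (4779578/10⁷)`** — on the determination-hull sub-box the
«MOS2-ndnio2-M21» obligation shape at the PEN's bar is met by one-body kinematics alone. CALIBRATION reading only: all many-body content of the rung leaf on
the box of record lives in the padding band; this closes no registered leaf. [cite: ScalapinoWhiteZhang1993, §II] [cite: HazraVermaRanderia2019, eqs. (2)-(6)] -/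
theorem stiffnessBoxCeilingBelow_boxNdNiO2E_M21det_kinematic :
    StiffnessBoxCeilingBelow boxNdNiO2E_M21det (4779578 / 10000000) := by
  refine stiffnessBoxCeilingBelow_of_holdsOn le_rfl ?_
  refine holdsOn_of_forall_s2Box (B := boxNdNiO2E_M21det) (eU := ndNiO2E_M21det_U) (eS := ndNiO2E_M21det_tp) (eN := ndNiO2E_M21det_n)
    rfl rfl rfl (W := fun θ => ObsStiffnessSeqCeilingAt (θ 1) (θ 0) (θ 2) (4779578 / 10000000)) ?_
  rw [ndNiO2E_M21det_s2LoHi.1, ndNiO2E_M21det_s2LoHi.2]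
  intro θ hθ
  obtain ⟨-, htθ, hnθ⟩ := mem_s2Box_vec3D hθ
  exact ndnio2_M21det_cell_kinematic_below_bar htθ hnθ

/-- The same below ANY bar `≥ 0.4779578` (a director bar above the PEN's re-uses it). [cite: ScalapinoWhiteZhang1993, §II] -/
theorem stiffnessBoxCeilingBelow_boxNdNiO2E_M21det_of_le {bar : ℚ} (hbar : 4779578 / 10000000 ≤ bar) :
    StiffnessBoxCeilingBelow boxNdNiO2E_M21det bar :=
  stiffnessBoxCeilingBelow_boxNdNiO2E_M21det_kinematic.mono hbar

end Summit.Ventures.CertifiedManyBodySolver.Observables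

end
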